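import Literature.MathematicalPhysics.QuantumFieldTheory.Balaban1983to89.B13Eq216AnalyticStep

/-!
# `Balaban1983to89.B13Eq216FirstForm` — T. Bałaban, *Renormalization group approach to lattice gauge field theories.
II. Cluster expansions*, Commun. Math. Phys. **116** (1988) 1–22 [Balaban1988RG2Cluster], pp. 15–16: the kernel
`R₁` of the FIRST quadratic form of (2.15) — *"For the quadratic form in the first exponential the difference is a
quadratic form ½⟨X, R₁X⟩, with matrix elements satisfying the bound (2.16)"* — CONSTRUCTED from the operators of
(2.14) and its entrywise bound (2.16) DERIVED from the (2.16)-type bounds of the two difference kernels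
`Γ_k(Z₀, σ, 𝐔, 𝐉) − Γ_k(Z₀, 0, U, 0)` and `C^{(k)}(Z₀, σ, 𝐔, 𝐉) − C^{(k)}(Z₀, 0, U, 0)` and the uniform localisation of the
operators themselves (the random-walk expansions of [13]/[15], L17a), by composition of exponentially localised kernels
on the unit lattice (the rate drops at each composition, the constant is the lattice O(1)).  With this file all three
replacement kernels `R₁`, `R₂` (= `−Re E`), `R₃` of p. 16 that `B13Bound226From216.norm_term214_le_226_of_216`
consumes in the printed entrywise shape are reduced to bounds on the PRIMITIVE objects: the analytically continued
covariance and `Γ`-operator and their `σ = 0`, `(U, 0)` values.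

statement-level skeleton of published theorems with citation tags; proofs where landed; nothing here is a claim about
the Yang–Mills mass gap

PDF held: `paper:balaban1988-cmp116-rg-ii-cluster` (journal page = PDF page + 0); pp. 15–16 re-read this session
(materialised `p0015.txt`/`p0016.txt`, render `pub-balaban/b2b-balaban-ref1/pages/1988-cmp116-rg-II-cluster/…-p016-x2.png`,
cell transcript `pub-balaban/b2b-balaban-b13/transcript-B13.md` ll. 146–152).

CITATION HEADER (verbatim, p. 15 [PDF 15] – p. 16 [PDF 16]): (2.14) *"… ∫dμ₀(X)|_Z exp(−½⟨Γ_k(Z₀, σ(Z))X,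
C^{(k)}(Z₀, σ(Z))Γ_k(Z₀, σ(Z))X⟩) …  where Γ_k(Z₀, σ(Z)) = C*Δ_k(σ(Z))CZ₀ᶜ(C^{(k)})^{1/2}(σ(Z))"*; (2.15) *"… ∫dμ₀(X)|_Z
exp(−½Re⟨Γ_k(Z₀,σ(Z))X, C^{(k)}(Z₀,σ(Z))Γ_k(Z₀,σ(Z))X⟩) …  In the expression on the right-hand side we replace the
operators by the corresponding operators with σ(Z) = 0, 𝐔 = U, 𝐉 = 0, and we estimate the error. For the quadratic form
in the first exponential the difference is a quadratic form ½⟨X, R₁X⟩, with matrix elements satisfying the bound*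
`|R₁(b, b′)| ≦ (O(1)e^{−⅓δ₀M} + O(α₀ + α₁)) exp(−½δ₀|b₋ − b′₋|).`  (2.16)"

WHAT IS REPRODUCED (unit `lit-balaban-r10` gen 11, B13 fold owner; SKELETON rows `B13.Eq2.16`, `B13.Eq2.15`,
`B13.Eq2.21` of `HOME/lit-balaban-r10/ROWS-B13.md`; the gen-11 HANDOFF open item «R₁, the composite first quadratic
form»).  Index sets: `Λ` (bonds of `Z₀`, where `B` lives) and `N` (bonds of `Z`, where `X` lives; in
`B13Bound226Assembly` `N = Λ ⊕ C₀`), LOCATED on ℤ^ν by maps `locΛ`, `locN` with at most `m` indices of `Λ` per site; weight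
`e^{−κ|loc i − loc j|₁}` (`B2Lemma25Proof.l1dist`).  The `Γ`-operator of (2.14) is LINEAR in `X`: `Γ(σ)X = G(σ)·X` with a
complex `Λ × N` kernel `G(σ)` (print: `Γ_k = C*Δ_k CZ₀ᶜ (C^{(k)})^{1/2}`, a product of linear operators); the covariance is
`C_σ = C^{(k)}(Z₀, σ) = A(σ)⁻¹` (`A` = the precision of `B13Term214.core214`).
* §1 `exp_mul_exp_le_split`, `conv_exp_l1dist_le` — composition of two located exponential weights: `Σ_j
  e^{−κ|x − loc j|₁}e^{−κ|loc j − y|₁} ≤ m(1 + 2/(κ−κ′))^ν · e^{−κ′|x − y|₁}` for `0 ≤ κ′ < κ` (triangle inequality + the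
  base-point lattice constant `B13Bound226From216.sum_exp_neg_l1dist_loc_le_pt`); `entry_mul_le` — the entries of a
  product of two located, exponentially bounded (rectangular, complex) kernels are bounded with the product constant
  times the lattice O(1), at any smaller rate; `entry_bound_mono_rate`, `entry_bound_transpose`.
* §2 `re_dotProduct_mulVec_ofReal`, `dotProduct_mulVec_triple`, **`hdef1_of_linear`** — with
  `R₁(σ) := Γ₀ᵀCΓ₀ − Re(G(σ)ᵀ C_σ G(σ))` (a real `N × N` kernel) the identity `Re⟨Γ(σ)X, A(σ)⁻¹Γ(σ)X⟩ = ⟨Γ₀X, CΓ₀X⟩ −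
  ⟨X, R₁(σ)X⟩` for real `X` — the hypothesis `hdef1` of `B13Bound226From216.norm_term214_le_226_of_216` (*"the
  difference is a quadratic form ½⟨X, R₁X⟩"*); `triple_sub_triple` — the algebra
  `GᵀC_σG − Γ₀ᵀCΓ₀ = (G − Γ₀)ᵀC_σG + Γ₀ᵀ(C_σ − C)G + Γ₀ᵀC(G − Γ₀)`.
* §3 `entry_triple_le`, **`h216R1_of_factors`** — IF `G(σ) − Γ₀` and `C_σ − C` obey the entrywise (2.16) with constants
  `θ_Γ`, `θ_C` at rate `κ` (the cross-paper leaf for the primitive objects; their `O(α₀ + α₁)` parts are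
  `B13Eq216AnalyticStep.h216_of_differentiableOn`), and `G(σ)`, `Γ₀`, `C_σ`, `C` are uniformly localised at rate `κ` with
  constants `K_G`, `K_Γ`, `K_{Cσ}`, `K₀` ([13]/[15], L17a), THEN
  `|R₁(σ)(b, b′)| ≤ Lc² · (θ_Γ K_{Cσ} K_G + K_Γ θ_C K_G + K_Γ K₀ θ_Γ) · e^{−κ″|b₋ − b′₋|₁}`, `Lc = m(1 + 2/(κ′ − κ″))^ν·…`
  (two compositions, rates `κ > κ′ > κ″ ≥ 0`) — the hypothesis `h216R1` of `B13Bound226From216` in its exact shape,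
  uniformly on the σ-polydisc, with the printed structure «small factor × O(1)» of the constant.
HONEST SCOPE.  Finite-dimensional kernel algebra only.  What stays by assertion (cross-paper, loci L16a/L17a): the
uniform localisation of `C^{(k)}(Z₀, σ)`, `Γ_k(Z₀, σ)` and the (2.16)-type bounds of their differences from the `σ = 0`,
`(U, 0)` values (for the `(𝐔, 𝐉)`-part see `B13Eq216AnalyticStep`; the σ-part `O(1)e^{−⅓δ₀M}` comes from the random-walk
expansions).  The rate loss `κ → κ″` at the two compositions is the mechanism of print's generic `½δ₀` (the tree's
`B6KernelComposition` records the same phenomenon for (2.68) of [B6] in the sup metric; here the ℓ¹ metric of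
`B13Eq216LatticeSum` and rectangular complex kernels).  No `sorry`, no definition, no new named fact (D-0026).
-/

noncomputable section

namespace Literature.MathematicalPhysics.QuantumFieldTheory.Balaban1983to89.B13Eq216FirstForm

open Metric Set Matrix
open B2Lemma25Proof (l1dist l1dist_nonneg l1dist_comm)
open B13Eq216LatticeSum (weightHyp_l1dist)
open B13Bound226From216 (sum_exp_neg_l1dist_loc_le_pt)

/-! ## §1. Composition of located exponential weights and of located kernels -/

section Composition

variable {ν : ℕ} {n p q : Type*} [Fintype n] {𝕜 : Type*} [RCLike 𝕜]

/-- The rate-splitting inequality behind every composition of exponentially localised kernels: if `c ≤ a + b`,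
`b ≥ 0` and `0 ≤ κ′ ≤ κ`, then `e^{−κa}·e^{−κb} ≤ e^{−κ′c}·e^{−(κ−κ′)a}` (keep the target rate `κ′` along the
triangle inequality, spend the surplus `κ − κ′` on the summation variable). [folklore]
[cite: Balaban1988RG2Cluster, (2.16) p.16 (the rate ½δ₀ of a composite kernel)] -/
theorem exp_mul_exp_le_split {a b c κ κ' : ℝ} (hc : c ≤ a + b) (hb : 0 ≤ b) (hκ' : 0 ≤ κ') (hκ : κ' ≤ κ) :
    Real.exp (-(κ * a)) * Real.exp (-(κ * b)) ≤ Real.exp (-(κ' * c)) * Real.exp (-((κ - κ') * a)) := by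
  rw [← Real.exp_add, ← Real.exp_add]
  refine Real.exp_le_exp.2 ?_
  have h1 : κ' * c ≤ κ' * (a + b) := mul_le_mul_of_nonneg_left hc hκ'
  have h2 : κ' * b ≤ κ * b := mul_le_mul_of_nonneg_right hκ hb
  nlinarith

/-- **Composition of two located exponential weights.**  If `loc : n → ℤ^ν` has at most `m` indices per site and
`0 ≤ κ′ < κ`, then for all `x, y ∈ ℤ^ν`:
`Σ_j e^{−κ|x − loc j|₁}·e^{−κ|loc j − y|₁} ≤ m(1 + 2/(κ − κ′))^ν · e^{−κ′|x − y|₁}` — the composite of two rate-`κ`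
weights decays at any smaller rate `κ′`, with the lattice constant of the surplus rate. [folklore]
[cite: Balaban1988RG2Cluster, (2.16) p.16] -/
theorem conv_exp_l1dist_le (loc : n → (Fin ν → ℤ)) {m : ℕ}
    (hfib : ∀ x : Fin ν → ℤ, (Finset.univ.filter fun j => loc j = x).card ≤ m) {κ κ' : ℝ} (hκ' : 0 ≤ κ')
    (hlt : κ' < κ) (x y : Fin ν → ℤ) :
    ∑ j, Real.exp (-(κ * l1dist x (loc j))) * Real.exp (-(κ * l1dist (loc j) y))
      ≤ m * (1 + 2 / (κ - κ')) ^ ν * Real.exp (-(κ' * l1dist x y)) := by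
  have htri : ∀ j, l1dist x y ≤ l1dist x (loc j) + l1dist (loc j) y := fun j =>
    (weightHyp_l1dist (n := Fin ν → ℤ) le_rfl id).tri x (loc j) y
  calc ∑ j, Real.exp (-(κ * l1dist x (loc j))) * Real.exp (-(κ * l1dist (loc j) y))
      ≤ ∑ j, Real.exp (-(κ' * l1dist x y)) * Real.exp (-((κ - κ') * l1dist x (loc j))) :=
        Finset.sum_le_sum fun j _ => exp_mul_exp_le_split (htri j) (l1dist_nonneg _ _) hκ' hlt.le
    _ = Real.exp (-(κ' * l1dist x y)) * ∑ j, Real.exp (-((κ - κ') * l1dist x (loc j))) := by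
        rw [Finset.mul_sum]
    _ ≤ Real.exp (-(κ' * l1dist x y)) * (m * (1 + 2 / (κ - κ')) ^ ν) :=
        mul_le_mul_of_nonneg_left (sum_exp_neg_l1dist_loc_le_pt (sub_pos.2 hlt) loc hfib x) (Real.exp_pos _).le
    _ = m * (1 + 2 / (κ - κ')) ^ ν * Real.exp (-(κ' * l1dist x y)) := by ring

/-- **Entries of a product of two located, exponentially bounded kernels** (rectangular, complex or real): if
`‖P(i,j)‖ ≤ θ_P e^{−κ|loc i − loc j|₁}` and `‖Q(j,k)‖ ≤ θ_Q e^{−κ|loc j − loc k|₁}` with the middle index set located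
with `≤ m` indices per site, then for `0 ≤ κ′ < κ`:
`‖(PQ)(i,k)‖ ≤ θ_Pθ_Q·m(1 + 2/(κ − κ′))^ν · e^{−κ′|loc i − loc k|₁}`. [folklore]
[cite: Balaban1988RG2Cluster, (2.16) p.16] -/
theorem entry_mul_le {P : Matrix p n 𝕜} {Q : Matrix n q 𝕜} {θP θQ κ κ' : ℝ} (hθP : 0 ≤ θP) (hθQ : 0 ≤ θQ)
    (hκ' : 0 ≤ κ') (hlt : κ' < κ) (locp : p → (Fin ν → ℤ)) (locn : n → (Fin ν → ℤ)) (locq : q → (Fin ν → ℤ))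
    {m : ℕ} (hfib : ∀ x : Fin ν → ℤ, (Finset.univ.filter fun j => locn j = x).card ≤ m)
    (hP : ∀ i j, ‖P i j‖ ≤ θP * Real.exp (-(κ * l1dist (locp i) (locn j))))
    (hQ : ∀ j k, ‖Q j k‖ ≤ θQ * Real.exp (-(κ * l1dist (locn j) (locq k)))) (i : p) (k : q) :
    ‖(P * Q) i k‖ ≤ θP * θQ * (m * (1 + 2 / (κ - κ')) ^ ν) * Real.exp (-(κ' * l1dist (locp i) (locq k))) := by
  rw [Matrix.mul_apply]
  calc ‖∑ j, P i j * Q j k‖ ≤ ∑ j, ‖P i j‖ * ‖Q j k‖ :=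
        (norm_sum_le _ _).trans (Finset.sum_le_sum fun j _ => norm_mul_le _ _)
    _ ≤ ∑ j, (θP * Real.exp (-(κ * l1dist (locp i) (locn j)))) * (θQ * Real.exp (-(κ * l1dist (locn j) (locq k)))) :=
        Finset.sum_le_sum fun j _ => mul_le_mul (hP i j) (hQ j k) (norm_nonneg _)
          (mul_nonneg hθP (Real.exp_pos _).le)
    _ = θP * θQ * ∑ j, Real.exp (-(κ * l1dist (locp i) (locn j))) * Real.exp (-(κ * l1dist (locn j) (locq k))) := by
        rw [Finset.mul_sum]
        exact Finset.sum_congr rfl fun j _ => by ring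
    _ ≤ θP * θQ * (m * (1 + 2 / (κ - κ')) ^ ν * Real.exp (-(κ' * l1dist (locp i) (locq k)))) :=
        mul_le_mul_of_nonneg_left (conv_exp_l1dist_le locn hfib hκ' hlt (locp i) (locq k)) (mul_nonneg hθP hθQ)
    _ = θP * θQ * (m * (1 + 2 / (κ - κ')) ^ ν) * Real.exp (-(κ' * l1dist (locp i) (locq k))) := by ring

omit [Fintype n] in
/-- An exponential entrywise bound persists at any smaller rate (`e^{−κd} ≤ e^{−κ′d}` for `κ′ ≤ κ`, `d ≥ 0`).
[folklore] [cite: Balaban1988RG2Cluster, (2.16) p.16] -/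
theorem entry_bound_mono_rate {P : Matrix p n 𝕜} {θ κ κ' : ℝ} (hθ : 0 ≤ θ) (hκ : κ' ≤ κ)
    (locp : p → (Fin ν → ℤ)) (locn : n → (Fin ν → ℤ))
    (hP : ∀ i j, ‖P i j‖ ≤ θ * Real.exp (-(κ * l1dist (locp i) (locn j)))) (i : p) (j : n) :
    ‖P i j‖ ≤ θ * Real.exp (-(κ' * l1dist (locp i) (locn j))) :=
  (hP i j).trans (mul_le_mul_of_nonneg_left
    (Real.exp_le_exp.2 (neg_le_neg (mul_le_mul_of_nonneg_right hκ (l1dist_nonneg _ _)))) hθ)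

omit [Fintype n] in
/-- The transpose of a located kernel obeys the bound with the location maps swapped (the weight is symmetric).
[folklore] [cite: Balaban1988RG2Cluster, (2.16) p.16] -/
theorem entry_bound_transpose {P : Matrix p n 𝕜} {θ κ : ℝ} (locp : p → (Fin ν → ℤ)) (locn : n → (Fin ν → ℤ))
    (hP : ∀ i j, ‖P i j‖ ≤ θ * Real.exp (-(κ * l1dist (locp i) (locn j)))) (j : n) (i : p) :
    ‖Pᵀ j i‖ ≤ θ * Real.exp (-(κ * l1dist (locn j) (locp i))) := by
  rw [Matrix.transpose_apply, l1dist_comm]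
  exact hP i j

end Composition

/-! ## §2. The kernel `R₁` of the first quadratic form -/

section FirstForm

variable {Λ N : Type} [Fintype Λ] [Fintype N] [DecidableEq Λ] [DecidableEq N]

omit [Fintype Λ] [DecidableEq Λ] [DecidableEq N] in
/-- The real part of a complex quadratic form at a REAL vector is the quadratic form of the real part of the kernel:
`Re⟨X, MX⟩ = ⟨X, (Re M)X⟩` for `X` real. [folklore] [cite: Balaban1988RG2Cluster, (2.15) p.15 (the passage to Re⟨…⟩)] -/
theorem re_dotProduct_mulVec_ofReal (M : Matrix N N ℂ) (X : N → ℝ) :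
    ((fun j => (X j : ℂ)) ⬝ᵥ (M *ᵥ fun j => (X j : ℂ))).re = X ⬝ᵥ (M.map Complex.re *ᵥ X) := by
  simp only [dotProduct, Matrix.mulVec, Complex.re_sum, Complex.re_ofReal_mul, Matrix.map_apply]
  refine Finset.sum_congr rfl fun i _ => ?_
  congr 1
  refine Finset.sum_congr rfl fun j _ => ?_
  rw [Complex.mul_re, Complex.ofReal_re, Complex.ofReal_im, mul_zero, sub_zero]

omit [DecidableEq Λ] [DecidableEq N] in
/-- `⟨Gx, K(Gx)⟩ = ⟨x, (GᵀKG)x⟩` (any commutative ring). [folklore] [cite: Balaban1988RG2Cluster, (2.15) p.15] -/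
theorem dotProduct_mulVec_triple {R : Type*} [CommRing R] (G : Matrix Λ N R) (K : Matrix Λ Λ R) (x : N → R) :
    (G *ᵥ x) ⬝ᵥ (K *ᵥ (G *ᵥ x)) = x ⬝ᵥ ((Gᵀ * K * G) *ᵥ x) := by
  rw [← Matrix.mulVec_mulVec, ← Matrix.mulVec_mulVec, Matrix.dotProduct_mulVec x Gᵀ, Matrix.vecMul_transpose]

omit [DecidableEq N] in
/-- **`hdef1`: the kernel of the first quadratic form** (*"For the quadratic form in the first exponential the
difference is a quadratic form ½⟨X, R₁X⟩"*).  If the `Γ`-operator of (2.14) acts linearly, `Γ(σ)X = G(σ)·X` with a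
complex `Λ × N` kernel, then with the covariance `C_σ := A(σ)⁻¹` and
`R₁(σ) := Γ₀ᵀCΓ₀ − Re(G(σ)ᵀ C_σ G(σ))`:  `Re⟨Γ(σ)X, A(σ)⁻¹Γ(σ)X⟩ = ⟨Γ₀X, CΓ₀X⟩ − ⟨X, R₁(σ)X⟩` for every real `X` —
the hypothesis `hdef1` of `B13Bound226From216.norm_term214_le_226_of_216` / `B13Replacement223.hR1_of_WRS`.
[cite: Balaban1988RG2Cluster, (2.15)–(2.16) pp.15–16] -/
theorem hdef1_of_linear (A : Matrix Λ Λ ℂ) (G : Matrix Λ N ℂ) (Γσ : (N → ℝ) → (Λ → ℂ))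
    (hlin : ∀ X : N → ℝ, Γσ X = G *ᵥ fun j => (X j : ℂ)) (C : Matrix Λ Λ ℝ) (Γ₀ : Matrix Λ N ℝ) (X : N → ℝ) :
    ((Γσ X) ⬝ᵥ (A⁻¹ *ᵥ Γσ X)).re
      = (Γ₀ *ᵥ X) ⬝ᵥ (C *ᵥ (Γ₀ *ᵥ X)) - X ⬝ᵥ ((Γ₀ᵀ * C * Γ₀ - (Gᵀ * A⁻¹ * G).map Complex.re) *ᵥ X) := by
  rw [hlin X, dotProduct_mulVec_triple, re_dotProduct_mulVec_ofReal, dotProduct_mulVec_triple Γ₀ C X,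
    Matrix.sub_mulVec, dotProduct_sub]
  ring

omit [Fintype N] [DecidableEq Λ] [DecidableEq N] in
/-- **The algebra of the replacement** for the first quadratic form: with `Γ₀`, `C` embedded in ℂ,
`GᵀC_σG − Γ₀ᵀCΓ₀ = (G − Γ₀)ᵀC_σG + Γ₀ᵀ(C_σ − C)G + Γ₀ᵀC(G − Γ₀)` — three terms, each a product of localised kernels with
ONE small (2.16)-factor. [folklore] [cite: Balaban1988RG2Cluster, (2.16) p.16] -/
theorem triple_sub_triple (G Γc : Matrix Λ N ℂ) (Cs Cc : Matrix Λ Λ ℂ) :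
    Gᵀ * Cs * G - Γcᵀ * Cc * Γc = (G - Γc)ᵀ * Cs * G + Γcᵀ * (Cs - Cc) * G + Γcᵀ * Cc * (G - Γc) := by
  rw [Matrix.transpose_sub, Matrix.sub_mul, Matrix.sub_mul, Matrix.mul_sub, Matrix.sub_mul, Matrix.mul_sub]
  abel

end FirstForm

/-! ## §3. (2.16) for `R₁` from the bounds of the primitive kernels -/

section Bound

variable {ν : ℕ} {Λ N : Type} [Fintype Λ]

/-- **Entries of a located triple product** `PᵀKQ` (`P, Q : Λ × N`, `K : Λ × Λ`, all complex): if `‖P(b,j)‖ ≤ θ_P·w`,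
`‖K(b,b′)‖ ≤ θ_K·w`, `‖Q(b,j)‖ ≤ θ_Q·w` with `w = e^{−κ|·−·|₁}` and `Λ` located with `≤ m` per site, then for rates
`κ > κ′ > κ″ ≥ 0`:  `‖(PᵀKQ)(i,l)‖ ≤ θ_Pθ_Kθ_Q·m(1+2/(κ−κ′))^ν·m(1+2/(κ′−κ″))^ν·e^{−κ″|loc i − loc l|₁}` (two
compositions, `entry_mul_le` twice). [folklore] [cite: Balaban1988RG2Cluster, (2.16) p.16] -/
theorem entry_triple_le {P Q : Matrix Λ N ℂ} {K : Matrix Λ Λ ℂ} {θP θK θQ κ κ' κ'' : ℝ} (hθP : 0 ≤ θP)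
    (hθK : 0 ≤ θK) (hθQ : 0 ≤ θQ) (hκ'' : 0 ≤ κ'') (h1 : κ'' < κ') (h2 : κ' < κ)
    (locΛ : Λ → (Fin ν → ℤ)) (locN : N → (Fin ν → ℤ)) {m : ℕ}
    (hfib : ∀ x : Fin ν → ℤ, (Finset.univ.filter fun b => locΛ b = x).card ≤ m)
    (hP : ∀ b j, ‖P b j‖ ≤ θP * Real.exp (-(κ * l1dist (locΛ b) (locN j))))
    (hK : ∀ b b', ‖K b b'‖ ≤ θK * Real.exp (-(κ * l1dist (locΛ b) (locΛ b'))))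
    (hQ : ∀ b j, ‖Q b j‖ ≤ θQ * Real.exp (-(κ * l1dist (locΛ b) (locN j)))) (i l : N) :
    ‖(Pᵀ * K * Q) i l‖ ≤ θP * θK * (m * (1 + 2 / (κ - κ')) ^ ν) * θQ * (m * (1 + 2 / (κ' - κ'')) ^ ν)
      * Real.exp (-(κ'' * l1dist (locN i) (locN l))) := by
  have hκ' : 0 ≤ κ' := hκ''.trans h1.le
  -- first composition: Pᵀ K at rate κ′
  have hPK : ∀ i b', ‖(Pᵀ * K) i b'‖ ≤ θP * θK * (m * (1 + 2 / (κ - κ')) ^ ν)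
      * Real.exp (-(κ' * l1dist (locN i) (locΛ b'))) :=
    entry_mul_le hθP hθK hκ' h2 locN locΛ locΛ hfib (entry_bound_transpose locΛ locN hP) hK
  -- second composition: (PᵀK) Q at rate κ″, Q weakened to rate κ′
  have hQ' : ∀ b j, ‖Q b j‖ ≤ θQ * Real.exp (-(κ' * l1dist (locΛ b) (locN j))) :=
    entry_bound_mono_rate hθQ h2.le locΛ locN hQ
  exact entry_mul_le (mul_nonneg (mul_nonneg hθP hθK) (by positivity)) hθQ hκ'' h1 locN locΛ locN hfib hPK hQ' i l

omit [Fintype Λ] in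
/-- An entrywise bound for a real kernel embedded in ℂ. [folklore] [cite: Balaban1988RG2Cluster, (2.16) p.16] -/
theorem entry_bound_map_ofReal {p n : Type*} {P : Matrix p n ℝ} {g : p → n → ℝ} (hP : ∀ i j, ‖P i j‖ ≤ g i j) :
    ∀ i j, ‖(P.map (algebraMap ℝ ℂ)) i j‖ ≤ g i j := fun i j => by
  rw [Matrix.map_apply, Complex.coe_algebraMap, Complex.norm_real]
  exact hP i j

/-- **(2.16) for `R₁` from the primitive kernels** (*"with matrix elements satisfying the bound (2.16)"*).  Let
`R₁ = Γ₀ᵀCΓ₀ − Re(GᵀC_σG)` (`hdef1_of_linear`).  Suppose, on bonds located on ℤ^ν (`Λ` with `≤ m` per site), at rate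
`κ`: the two DIFFERENCE kernels obey the entrywise (2.16) — `‖(G − Γ₀)(b,j)‖ ≤ θ_Γ e^{−κ|·|₁}`,
`‖(C_σ − C)(b,b′)‖ ≤ θ_C e^{−κ|·|₁}` (the leaf for the primitive objects of [13]/[15]) — and the kernels themselves are
uniformly localised — `‖G‖ ≤ K_G e^{−κ|·|₁}`, `‖Γ₀‖ ≤ K_Γ e^{−κ|·|₁}`, `‖C_σ‖ ≤ K_{Cσ} e^{−κ|·|₁}`, `‖C‖ ≤ K₀ e^{−κ|·|₁}`
(L17a).  Then for rates `κ > κ′ > κ″ ≥ 0`, with `Lc = m(1+2/(κ−κ′))^ν · m(1+2/(κ′−κ″))^ν`: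
`|R₁(i, l)| ≤ Lc·(θ_Γ K_{Cσ} K_G + K_Γ θ_C K_G + K_Γ K₀ θ_Γ)·e^{−κ″|loc i − loc l|₁}` — every term carries ONE small
factor `θ`, i.e. the printed «(O(1)e^{−⅓δ₀M} + O(α₀ + α₁))·exp(−κ″|b₋ − b′₋|)» with the O(1) = the lattice constant ×
the localisation norms. [cite: Balaban1988RG2Cluster, (2.16) p.16] -/
theorem h216R1_of_factors {G : Matrix Λ N ℂ} {Γ₀ : Matrix Λ N ℝ} {Cs : Matrix Λ Λ ℂ} {C : Matrix Λ Λ ℝ}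
    {θΓ θC KG KΓ KCs K₀ κ κ' κ'' : ℝ} (hθΓ : 0 ≤ θΓ) (hθC : 0 ≤ θC) (hKG : 0 ≤ KG) (hKΓ : 0 ≤ KΓ)
    (hKCs : 0 ≤ KCs) (hK₀ : 0 ≤ K₀) (hκ'' : 0 ≤ κ'') (h1 : κ'' < κ') (h2 : κ' < κ)
    (locΛ : Λ → (Fin ν → ℤ)) (locN : N → (Fin ν → ℤ)) {m : ℕ}
    (hfib : ∀ x : Fin ν → ℤ, (Finset.univ.filter fun b => locΛ b = x).card ≤ m)
    (hdΓ : ∀ b j, ‖(G - Γ₀.map (algebraMap ℝ ℂ)) b j‖ ≤ θΓ * Real.exp (-(κ * l1dist (locΛ b) (locN j))))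
    (hdC : ∀ b b', ‖(Cs - C.map (algebraMap ℝ ℂ)) b b'‖ ≤ θC * Real.exp (-(κ * l1dist (locΛ b) (locΛ b'))))
    (hG : ∀ b j, ‖G b j‖ ≤ KG * Real.exp (-(κ * l1dist (locΛ b) (locN j))))
    (hΓ₀ : ∀ b j, ‖Γ₀ b j‖ ≤ KΓ * Real.exp (-(κ * l1dist (locΛ b) (locN j))))
    (hCs : ∀ b b', ‖Cs b b'‖ ≤ KCs * Real.exp (-(κ * l1dist (locΛ b) (locΛ b'))))
    (hC : ∀ b b', ‖C b b'‖ ≤ K₀ * Real.exp (-(κ * l1dist (locΛ b) (locΛ b')))) (i l : N) :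
    ‖(Γ₀ᵀ * C * Γ₀ - (Gᵀ * Cs * G).map Complex.re) i l‖
      ≤ (m * (1 + 2 / (κ - κ')) ^ ν) * (m * (1 + 2 / (κ' - κ'')) ^ ν)
          * (θΓ * KCs * KG + KΓ * θC * KG + KΓ * K₀ * θΓ) * Real.exp (-(κ'' * l1dist (locN i) (locN l))) := by
  set Γc : Matrix Λ N ℂ := Γ₀.map (algebraMap ℝ ℂ) with hΓc
  set Cc : Matrix Λ Λ ℂ := C.map (algebraMap ℝ ℂ) with hCc
  set L1 : ℝ := m * (1 + 2 / (κ - κ')) ^ ν with hL1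
  set L2 : ℝ := m * (1 + 2 / (κ' - κ'')) ^ ν with hL2
  set w : ℝ := Real.exp (-(κ'' * l1dist (locN i) (locN l))) with hw
  -- the real kernel is the real part of the complex difference
  have hreal : (Γ₀ᵀ * C * Γ₀ - (Gᵀ * Cs * G).map Complex.re) i l
      = -((Gᵀ * Cs * G - Γcᵀ * Cc * Γc) i l).re := by
    have e1 : (Γcᵀ * Cc * Γc) = (Γ₀ᵀ * C * Γ₀).map (algebraMap ℝ ℂ) := by
      rw [hΓc, hCc, ← Matrix.transpose_map, ← Matrix.map_mul, ← Matrix.map_mul]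
    rw [Matrix.sub_apply, Matrix.map_apply, Matrix.sub_apply, e1, Matrix.map_apply, Complex.sub_re,
      Complex.coe_algebraMap, Complex.ofReal_re]
    ring
  rw [hreal, norm_neg, Real.norm_eq_abs]
  refine (Complex.abs_re_le_norm _).trans ?_
  rw [triple_sub_triple G Γc Cs Cc, Matrix.add_apply, Matrix.add_apply]
  -- the three located triple products
  have hΓc' : ∀ b j, ‖Γc b j‖ ≤ KΓ * Real.exp (-(κ * l1dist (locΛ b) (locN j))) := entry_bound_map_ofReal hΓ₀
  have hCc' : ∀ b b', ‖Cc b b'‖ ≤ K₀ * Real.exp (-(κ * l1dist (locΛ b) (locΛ b'))) := entry_bound_map_ofReal hC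
  have t1 := entry_triple_le (P := G - Γc) (K := Cs) (Q := G) hθΓ hKCs hKG hκ'' h1 h2 locΛ locN hfib hdΓ hCs hG i l
  have t2 := entry_triple_le (P := Γc) (K := Cs - Cc) (Q := G) hKΓ hθC hKG hκ'' h1 h2 locΛ locN hfib hΓc' hdC hG i l
  have t3 := entry_triple_le (P := Γc) (K := Cc) (Q := G - Γc) hKΓ hK₀ hθΓ hκ'' h1 h2 locΛ locN hfib hΓc' hCc' hdΓ
    i l
  rw [← hL1, ← hL2, ← hw] at t1 t2 t3
  calc ‖((G - Γc)ᵀ * Cs * G) i l + (Γcᵀ * (Cs - Cc) * G) i l + (Γcᵀ * Cc * (G - Γc)) i l‖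
      ≤ ‖((G - Γc)ᵀ * Cs * G) i l‖ + ‖(Γcᵀ * (Cs - Cc) * G) i l‖ + ‖(Γcᵀ * Cc * (G - Γc)) i l‖ :=
        norm_add₃_le
    _ ≤ θΓ * KCs * L1 * KG * L2 * w + KΓ * θC * L1 * KG * L2 * w + KΓ * K₀ * L1 * θΓ * L2 * w :=
        add_le_add (add_le_add t1 t2) t3
    _ = L1 * L2 * (θΓ * KCs * KG + KΓ * θC * KG + KΓ * K₀ * θΓ) * w := by ring

/-- **The hypothesis `h216R1` of `B13Bound226From216.norm_term214_le_226_of_216`, uniformly on the σ-polydisc**: for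
σ-families `G(σ)`, `C_σ(σ)` with the σ-uniform bounds of `h216R1_of_factors`, the kernel
`R₁(σ) := Γ₀ᵀCΓ₀ − Re(G(σ)ᵀC_σ(σ)G(σ))` obeys `‖R₁(σ)(b,b′)‖ ≤ θ′·e^{−κ″|b₋ − b′₋|₁}` for every `σ` of the polydisc,
`θ′ = Lc·(θ_Γ K_{Cσ} K_G + K_Γ θ_C K_G + K_Γ K₀ θ_Γ)`. [cite: Balaban1988RG2Cluster, (2.16) p.16] -/
theorem h216R1_uniform {ι : Type*} (Rσ : ι → ℝ) {G : (ι → ℂ) → Matrix Λ N ℂ} {Γ₀ : Matrix Λ N ℝ}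
    {Cs : (ι → ℂ) → Matrix Λ Λ ℂ} {C : Matrix Λ Λ ℝ} {θΓ θC KG KΓ KCs K₀ κ κ' κ'' : ℝ} (hθΓ : 0 ≤ θΓ)
    (hθC : 0 ≤ θC) (hKG : 0 ≤ KG) (hKΓ : 0 ≤ KΓ) (hKCs : 0 ≤ KCs) (hK₀ : 0 ≤ K₀) (hκ'' : 0 ≤ κ'')
    (h1 : κ'' < κ') (h2 : κ' < κ) (locΛ : Λ → (Fin ν → ℤ)) (locN : N → (Fin ν → ℤ)) {m : ℕ}
    (hfib : ∀ x : Fin ν → ℤ, (Finset.univ.filter fun b => locΛ b = x).card ≤ m)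
    (hdΓ : ∀ σ : ι → ℂ, (∀ j, ‖σ j‖ ≤ Rσ j) →
      ∀ b j, ‖(G σ - Γ₀.map (algebraMap ℝ ℂ)) b j‖ ≤ θΓ * Real.exp (-(κ * l1dist (locΛ b) (locN j))))
    (hdC : ∀ σ : ι → ℂ, (∀ j, ‖σ j‖ ≤ Rσ j) →
      ∀ b b', ‖(Cs σ - C.map (algebraMap ℝ ℂ)) b b'‖ ≤ θC * Real.exp (-(κ * l1dist (locΛ b) (locΛ b'))))
    (hG : ∀ σ : ι → ℂ, (∀ j, ‖σ j‖ ≤ Rσ j) → ∀ b j, ‖G σ b j‖ ≤ KG * Real.exp (-(κ * l1dist (locΛ b) (locN j))))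
    (hΓ₀ : ∀ b j, ‖Γ₀ b j‖ ≤ KΓ * Real.exp (-(κ * l1dist (locΛ b) (locN j))))
    (hCs : ∀ σ : ι → ℂ, (∀ j, ‖σ j‖ ≤ Rσ j) →
      ∀ b b', ‖Cs σ b b'‖ ≤ KCs * Real.exp (-(κ * l1dist (locΛ b) (locΛ b'))))
    (hC : ∀ b b', ‖C b b'‖ ≤ K₀ * Real.exp (-(κ * l1dist (locΛ b) (locΛ b')))) :
    ∀ σ : ι → ℂ, (∀ j, ‖σ j‖ ≤ Rσ j) →
      ∀ i l, ‖(Γ₀ᵀ * C * Γ₀ - ((G σ)ᵀ * Cs σ * G σ).map Complex.re) i l‖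
        ≤ (m * (1 + 2 / (κ - κ')) ^ ν) * (m * (1 + 2 / (κ' - κ'')) ^ ν)
            * (θΓ * KCs * KG + KΓ * θC * KG + KΓ * K₀ * θΓ) * Real.exp (-(κ'' * l1dist (locN i) (locN l))) :=
  fun σ hσ i l => h216R1_of_factors hθΓ hθC hKG hKΓ hKCs hK₀ hκ'' h1 h2 locΛ locN hfib (hdΓ σ hσ) (hdC σ hσ)
    (hG σ hσ) hΓ₀ (hCs σ hσ) hC i l

end Bound

end Literature.MathematicalPhysics.QuantumFieldTheory.Balaban1983to89.B13Eq216FirstForm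

end
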